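import Literature.NumberTheory.DiophantineGeometry.PlaneCurveRationalPlaceProofs
import HarnessLib

/-!
# Two-sided bounds for the number of rational places (Hasse–Weil, Stichtenoth Thm. 5.2.3) and
counting places among the zeros and poles of a function

Library file continuing the function-field chain (`FunctionFieldDivisors` … `FunctionFieldHasseWeilProofs`,
`PlaneCurveRationalPlaceProofs`). For an algebraic function field `F/𝔽_q` of one variable with full
constant field `𝔽_q` and genus `g`, `PlaneCurveRationalPlaceProofs.le_numPlacesOfDegree_one` extracts
from the Hasse–Weil theorem the lower bound `q + 1 - 2g√q ≤ N` for the number `N = N₁` of rational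
places. Here we add

* `numPlacesOfDegree_one_le`: the **upper bound** `N ≤ q + 1 + 2g√q`, and the two-sided form
  `abs_numPlacesOfDegree_one_sub_le`: `|N - (q + 1)| ≤ 2g√q` (Stichtenoth Thm. 5.2.3);
* `card_le_degree_negPart_of_forall_not_mem`, `card_le_finrank_of_forall_not_mem`: a set of places
  all of which are poles of `x` has at most `deg (x)_∞ = [F : K(x)]` elements;
* `degree_posPart_principalDivisor_eq`, `card_le_degree_posPart_of_forall_ord_pos`,
  `card_le_finrank_of_forall_ord_sub_pos`: `deg (x)_0 = deg (x)_∞`, so a set of places all of which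
  are zeros of `x - a` (`a ∈ K`) has at most `[F : K(x)]` elements.

These are the counting inputs of the two-sided Weil estimate for the number of rational points of a
(possibly singular) affine plane curve (Cafure–Matera 2006, eq. (1) and Lemma 5.1; Aubry–Perret 1996):
rational places at infinity and rational places above a given value `x = a` are each at most
`[F : K(x)]` in number.

## References

* H. Stichtenoth, *Algebraic Function Fields and Codes*, 2nd ed., GTM 254, Springer 2009,
  Thm. 1.4.11, Cor. 5.1.16, Thm. 5.2.1, Thm. 5.2.3. [Stichtenoth2009]
* A. Cafure, G. Matera, *Improved explicit estimates on the number of solutions of equations over a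
  finite field*, Finite Fields Appl. 12 (2006) 155–185, §1 eq. (1), Lemma 5.1. [CafureMatera2006]
-/

noncomputable section

open scoped Classical IntermediateField

namespace Literature.NumberTheory.DiophantineGeometry.AlgFunctionField

universe u v

variable {K : Type u} {F : Type v} [Field K] [Field F] [Algebra K F]

/-! ### Counting places among the poles and zeros of a function -/

/-- A finite set of places all of which are poles of `x ≠ 0` has at most `deg (x)_∞` elements
(every pole lies in the support of the effective divisor `(x)_∞`, and a place has degree `≥ 1`).
[cite: Stichtenoth2009, Thm. 1.4.11] -/
theorem card_le_degree_negPart_of_forall_not_mem [IsAlgFunctionField K F] {x : F} (hx : x ≠ 0)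
    (S : Finset (PlaceOver K F)) (hS : ∀ P ∈ S, x ∉ P.toValuationSubring) :
    (S.card : ℤ) ≤ Divisor.degree (principalDivisor K x)⁻ := by
  have hsub : S ⊆ ((principalDivisor K x)⁻).support := fun P hP ↦
    mem_support_negPart_principalDivisor hx (hS P hP)
  exact (Nat.cast_le.2 (Finset.card_le_card hsub)).trans (card_support_le_degree (negPart_nonneg _))

/-- A finite set of places all of which are poles of a transcendental `x` has at most `[F : K(x)]`
elements (`deg (x)_∞ = [F : K(x)]`, Stichtenoth Thm. 1.4.11). [cite: Stichtenoth2009, Thm. 1.4.11] -/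
theorem card_le_finrank_of_forall_not_mem [IsAlgFunctionField K F] {x : F} (hx : Transcendental K x)
    (S : Finset (PlaceOver K F)) (hS : ∀ P ∈ S, x ∉ P.toValuationSubring) :
    S.card ≤ Module.finrank K⟮x⟯ F := by
  have hx0 : x ≠ 0 := fun h ↦ hx (h ▸ isAlgebraic_zero)
  have h := card_le_degree_negPart_of_forall_not_mem hx0 S hS
  rw [degree_negPart_principalDivisor_eq hx] at h
  exact_mod_cast h

/-- A zero of `x ≠ 0` lies in the support of the zero divisor `(x)_0 = (x)⁺`. [folklore] -/
theorem mem_support_posPart_principalDivisor [IsAlgFunctionField K F] {x : F} (hx : x ≠ 0)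
    {v : PlaceOver K F} (hv : 0 < v.ord x) : v ∈ ((principalDivisor K x)⁺).support := by
  rw [Finsupp.mem_support_iff, Divisor.posPart_apply, principalDivisor_apply_of_ne_zero hx]
  have : max (v.ord x) 0 = v.ord x := max_eq_left hv.le
  omega

/-- **`deg (x)_0 = deg (x)_∞`** (Stichtenoth Thm. 1.4.11): the zero divisor and the pole divisor of
`x ≠ 0` have the same degree, since `(x) = (x)_0 - (x)_∞` has degree `0`.
[cite: Stichtenoth2009, Thm. 1.4.11] -/
theorem degree_posPart_principalDivisor_eq [IsAlgFunctionField K F] {x : F} (hx : x ≠ 0) :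
    Divisor.degree (principalDivisor K x)⁺ = Divisor.degree (principalDivisor K x)⁻ := by
  have h0 := degree_principalDivisor_eq_zero (K := K) hx
  have h1 : (principalDivisor K x)⁺ - (principalDivisor K x)⁻ = principalDivisor K x :=
    posPart_sub_negPart _
  have h2 := congrArg Divisor.degree h1
  rw [map_sub, h0] at h2
  linarith

/-- A finite set of places all of which are zeros of `x ≠ 0` has at most `deg (x)_0 = deg (x)_∞`
elements. [cite: Stichtenoth2009, Thm. 1.4.11] -/
theorem card_le_degree_posPart_of_forall_ord_pos [IsAlgFunctionField K F] {x : F} (hx : x ≠ 0)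
    (S : Finset (PlaceOver K F)) (hS : ∀ P ∈ S, 0 < P.ord x) :
    (S.card : ℤ) ≤ Divisor.degree (principalDivisor K x)⁻ := by
  have hsub : S ⊆ ((principalDivisor K x)⁺).support := fun P hP ↦
    mem_support_posPart_principalDivisor hx (hS P hP)
  rw [← degree_posPart_principalDivisor_eq hx]
  exact (Nat.cast_le.2 (Finset.card_le_card hsub)).trans (card_support_le_degree (posPart_nonneg _))

/-- Translating a transcendental element by a constant keeps it transcendental. [folklore] -/
theorem transcendental_sub_algebraMap {x : F} (hx : Transcendental K x) (a : K) :
    Transcendental K (x - algebraMap K F a) := fun h ↦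
  hx (by simpa using h.add (isAlgebraic_algebraMap a))

/-- `K(x - a) = K(x)` for a constant `a`. [folklore] -/
theorem adjoin_simple_sub_algebraMap (x : F) (a : K) : K⟮x - algebraMap K F a⟯ = K⟮x⟯ := by
  apply le_antisymm
  · rw [IntermediateField.adjoin_simple_le_iff]
    exact sub_mem (IntermediateField.mem_adjoin_simple_self K x) (algebraMap_mem _ a)
  · rw [IntermediateField.adjoin_simple_le_iff]
    have h := add_mem (IntermediateField.mem_adjoin_simple_self K (x - algebraMap K F a))
      (algebraMap_mem K⟮x - algebraMap K F a⟯ a)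
    simpa using h

/-- **At most `[F : K(x)]` places lie above `x = a`.** A finite set of places all of which are zeros
of `x - a` (`x` transcendental, `a ∈ K`) has at most `[F : K(x)]` elements:
`deg (x - a)_0 = deg (x - a)_∞ = [F : K(x - a)] = [F : K(x)]` (Stichtenoth Thm. 1.4.11).
[cite: Stichtenoth2009, Thm. 1.4.11] -/
theorem card_le_finrank_of_forall_ord_sub_pos [IsAlgFunctionField K F] {x : F}
    (hx : Transcendental K x) (a : K) (S : Finset (PlaceOver K F))
    (hS : ∀ P ∈ S, 0 < P.ord (x - algebraMap K F a)) :
    S.card ≤ Module.finrank K⟮x⟯ F := by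
  have hz := transcendental_sub_algebraMap hx a
  have hz0 : x - algebraMap K F a ≠ 0 := fun h ↦ hz (h ▸ isAlgebraic_zero)
  have h := card_le_degree_posPart_of_forall_ord_pos hz0 S hS
  rw [degree_negPart_principalDivisor_eq hz, adjoin_simple_sub_algebraMap] at h
  exact_mod_cast h

/-! ### The Hasse–Weil upper bound for the number of rational places -/

section Finite

variable [Fintype K] [IsAlgFunctionField K F] [IsIntegrallyClosedIn K F]

/-- **The Hasse–Weil bound (Stichtenoth Thm. 5.2.3), upper half:** the number `N` of rational
places of a function field `F/𝔽_q` with full constant field `𝔽_q` and genus `g` satisfies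
`N ≤ q + 1 + 2g√q`. From `N = q + 1 - ∑_{i=1}^{2g} αᵢ` (Cor. 5.1.16) with `|αᵢ| = √q`
(Thm. 5.2.1, `hasseWeil_holds`), using `Re αᵢ ≥ -|αᵢ|`. [cite: Stichtenoth2009, Thm. 5.2.3] -/
theorem numPlacesOfDegree_one_le :
    (numPlacesOfDegree K F 1 : ℝ) ≤
      (Fintype.card K : ℝ) + 1 + 2 * genus K F * √(Fintype.card K : ℝ) := by
  obtain ⟨α, hα, hN⟩ := exists_pointCount_eq_of_facts (K := K) (F := F)
    lSeries_eq_polynomial_holds hasseWeil_holds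
  have h1 := congrArg Complex.re (hN 1 one_pos)
  rw [pointCount_one] at h1
  simp only [pow_one, Complex.natCast_re, Complex.sub_re, Complex.add_re, Complex.one_re,
    Complex.re_sum] at h1
  have hre : ∀ i, -√(Fintype.card K : ℝ) ≤ (α i).re := fun i ↦ by
    have h := Complex.abs_re_le_norm (α i)
    rw [hα i] at h
    exact (abs_le.1 h).1
  have hsum : -(2 * genus K F * √(Fintype.card K : ℝ)) ≤ ∑ i, (α i).re := by
    calc -(2 * genus K F * √(Fintype.card K : ℝ))
          = ∑ _i : Fin (2 * genus K F), -√(Fintype.card K : ℝ) := by simp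
      _ ≤ ∑ i, (α i).re := Finset.sum_le_sum fun i _ ↦ hre i
  rw [h1]
  linarith

/-- **The Hasse–Weil bound (Stichtenoth Thm. 5.2.3):** `|N - (q + 1)| ≤ 2g√q` for the number `N` of
rational places of a function field `F/𝔽_q` with full constant field `𝔽_q` and genus `g`.
[cite: Stichtenoth2009, Thm. 5.2.3] -/
theorem abs_numPlacesOfDegree_one_sub_le :
    |(numPlacesOfDegree K F 1 : ℝ) - ((Fintype.card K : ℝ) + 1)| ≤
      2 * genus K F * √(Fintype.card K : ℝ) := by
  rw [abs_le]
  have h1 := le_numPlacesOfDegree_one (K := K) (F := F)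
  have h2 := numPlacesOfDegree_one_le (K := K) (F := F)
  constructor <;> linarith

/-- The number of rational places, as the cardinality of the finite set of places of degree one, in
the two-sided Hasse–Weil form: `q + 1 - 2g√q ≤ #{P : deg P = 1} ≤ q + 1 + 2g√q`.
[cite: Stichtenoth2009, Thm. 5.2.3] -/
theorem card_toFinset_degree_eq_one_mem_Icc :
    ((finite_setOf_degree_eq (K := K) (F := F) 1).toFinset.card : ℝ) ∈
      Set.Icc ((Fintype.card K : ℝ) + 1 - 2 * genus K F * √(Fintype.card K : ℝ))
        ((Fintype.card K : ℝ) + 1 + 2 * genus K F * √(Fintype.card K : ℝ)) := by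
  rw [← numPlacesOfDegree_eq_card]
  exact ⟨le_numPlacesOfDegree_one, numPlacesOfDegree_one_le⟩

end Finite

end Literature.NumberTheory.DiophantineGeometry.AlgFunctionField

end
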